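import Mathlib.Tactic.Group
import HarnessLib

/-!
# [IUTchII] Rmk. 1.1.1 (iii): four commutator identities behind the bilinearity of the commutator pairing
# `[-,-] : (Δ_X(M)/Δ_Y(M)) × Δ^ell_Y(M) → Π_M|_{(l·Δ_Θ)(M)}`

Mochizuki, *Inter-universal Teichmüller theory II*, §1, Remark 1.1.1 (iii), kurims manuscript (Dec. 2020) p. 23
[claim: Mochizuki2012, status: disputed] (IUTchII §1 Rmk 1.1.1 (iii), kurims p.23): "one obtains a natural bilinear
commutator map `[-,-] : (Δ_X(M)/Δ_Y(M)) × Δ^ell_Y(M) → Π_M|_{(l·Δ_Θ)(M)}`". abc-iut cell, layer L6, NV-L6 row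
**TwoSections** (seat abc-iut-w5-d225 gen 5): the pure group theory used by `TwoSectionsNonVacuity.lean` — with
`[g,h] := g h g⁻¹ h⁻¹`, the pairing is multiplicative in each variable and independent of lifts as soon as the relevant
commutators are central ("`Δ_Θ` is central in `(Δ^tp_X)^Θ`", [EtTh] §1 p. 12) and the lift corrections commute with the
other argument ("`(Δ^tp_Y)^Θ` abelian"). Elementary identities in an arbitrary group (folklore); nothing of [IUTchII] is
asserted; no side taken on [IUTchIII] Cor. 3.12. [cite: MochizukiEtTh2009, §1 p.12]
-/

namespace Literature.IUT.HodgeArakelov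

section GroupLemmas

variable {G : Type*} [Group G]

/-- `[g, h₁h₂] = [g,h₁]·[g,h₂]` when `[g,h₂]` commutes with `h₁` (bilinearity of the commutator pairing in the
second variable, [IUTchII] Rmk. 1.1.1 (iii) "bilinear"). [claim: Mochizuki2012, status: disputed] (IUTchII §1 Rmk 1.1.1 (iii), kurims p.23) -/
theorem conjComm_mul_right (g h₁ h₂ : G)
    (hd : h₁ * (g * h₂ * g⁻¹ * h₂⁻¹) = (g * h₂ * g⁻¹ * h₂⁻¹) * h₁) :
    g * (h₁ * h₂) * g⁻¹ * (h₁ * h₂)⁻¹ = (g * h₁ * g⁻¹ * h₁⁻¹) * (g * h₂ * g⁻¹ * h₂⁻¹) := by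
  have h1 : g * (h₁ * h₂) * g⁻¹ * (h₁ * h₂)⁻¹ = g * h₁ * g⁻¹ * ((g * h₂ * g⁻¹ * h₂⁻¹) * h₁⁻¹) := by
    group
  have h2 : (g * h₂ * g⁻¹ * h₂⁻¹) * h₁⁻¹ = h₁⁻¹ * (g * h₂ * g⁻¹ * h₂⁻¹) := by
    rw [eq_inv_mul_iff_mul_eq, ← mul_assoc, hd, mul_assoc, mul_inv_cancel, mul_one]
  rw [h1, h2]
  group

/-- `[g₁g₂, h] = [g₁,h]·[g₂,h]` when `[g₂,h]` commutes with `g₁` and with `[g₁,h]` (bilinearity in the first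
variable). [claim: Mochizuki2012, status: disputed] (IUTchII §1 Rmk 1.1.1 (iii), kurims p.23) -/
theorem conjComm_mul_left (g₁ g₂ h : G)
    (h1 : g₁ * (g₂ * h * g₂⁻¹ * h⁻¹) = (g₂ * h * g₂⁻¹ * h⁻¹) * g₁)
    (h2 : (g₁ * h * g₁⁻¹ * h⁻¹) * (g₂ * h * g₂⁻¹ * h⁻¹) =
      (g₂ * h * g₂⁻¹ * h⁻¹) * (g₁ * h * g₁⁻¹ * h⁻¹)) :
    (g₁ * g₂) * h * (g₁ * g₂)⁻¹ * h⁻¹ = (g₁ * h * g₁⁻¹ * h⁻¹) * (g₂ * h * g₂⁻¹ * h⁻¹) := by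
  have e1 : (g₁ * g₂) * h * (g₁ * g₂)⁻¹ * h⁻¹ = g₁ * (g₂ * h * g₂⁻¹ * h⁻¹) * (h * g₁⁻¹ * h⁻¹) := by
    group
  rw [e1, h1, h2]
  group

/-- `[g, hc] = [g,h]` when `c` commutes with `g` (independence of the `Δ_Y(M)`-lift modulo `Ker(Δ_Y ↠ Δ^ell_Y)`).
[claim: Mochizuki2012, status: disputed] (IUTchII §1 Rmk 1.1.1 (iii), kurims p.23) -/
theorem conjComm_mul_central_right (g h c : G) (hcg : c * g⁻¹ = g⁻¹ * c) :
    g * (h * c) * g⁻¹ * (h * c)⁻¹ = g * h * g⁻¹ * h⁻¹ := by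
  have e1 : g * (h * c) * g⁻¹ * (h * c)⁻¹ = g * h * (c * g⁻¹) * c⁻¹ * h⁻¹ := by group
  rw [e1, hcg]
  group

/-- `[gδ, h] = [g,h]` when `δ` commutes with `h` (independence of the `Δ_X(M)`-lift modulo `Δ_Y(M)`).
[claim: Mochizuki2012, status: disputed] (IUTchII §1 Rmk 1.1.1 (iii), kurims p.23) -/
theorem conjComm_central_mul_left (g δ h : G) (hδ : δ * h = h * δ) :
    (g * δ) * h * (g * δ)⁻¹ * h⁻¹ = g * h * g⁻¹ * h⁻¹ := by
  have e1 : (g * δ) * h * (g * δ)⁻¹ * h⁻¹ = g * (δ * h) * δ⁻¹ * g⁻¹ * h⁻¹ := by group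
  rw [e1, hδ]
  group

end GroupLemmas

end Literature.IUT.HodgeArakelov

-- build-queue re-enqueue (comment-only re-land by abc-iut-w4-d014 g7, 2026-08-26T10:3xZ): declarations byte-identical to p436592 (tree sha16 83e9921f8c44d59b);
-- purpose: produce the missing olean (stranded accept) so that p437698 TwoSectionsNonVacuity (deferred x5 «no-olean») can verify.
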